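import Summits.Ventures.PercRepro.RankLevelSetTightSurplus

/-!
# PercRepro — [WORKAROUND COPY, (um)(35)(2)–(4): the primed (`_S`) re-statement of RankLevelSetTightPairs, whose landed copy (the citation of record) has no olean; every declaration carries the `_S` suffix]
# THE DEPENDENT p-SETS WITH AN INDEPENDENT e-FREE PART, AND THEIR PAIRS (night-1, gen 9; §19.6)

For a non-loop `e` let `xSets_S M e p` be the dependent `p`-subsets `X` of `E` with `e ∈ X` and `X ∖ e`
independent.  Every `u`-subset of `X ∖ e` is an independent `u`-set avoiding `e` contained in the dependent `X`,
so the surplus sums of `RankLevelSetTightSurplus` are bounded below by the number of such `X`: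

* `xSets_mul_choose_le_depSumAvoid_S` — `#xSets_S · C(p−1, u) ≤ Σ_{Z ∈ I_u, e ∉ Z} dep_p(Z)` for `u ≤ p − 1`;
* `xSets_mul_choose_pred_le_sum_depCount_contract_S` — if every circuit through `e` has size `≥ q + 1`, then
  `#xSets_S · (C(p−1, q) − 1) ≤ Σ_{Z′ ∈ I_q(M／e)} dep^{M／e}_{p−1}(Z′)` (at most one `q`-subset `Z′` of `X ∖ e`
  has `Z′ ∪ e` dependent: it would be a circuit of size `q + 1`, and two of them eliminate to a circuit inside
  the independent `X ∖ e`).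

RankLevelSetTightTails counts `#xSets_S` from below by the partitions of `U`.  Axioms: standard.
-/

open scoped Matroid

namespace PercRepro

open Set Finset
open scoped Classical

variable {α : Type} (M : Matroid α) [M.Finite]

/-- The ground set as a `Finset`. -/
noncomputable abbrev groundFinset_S : Finset α := (M.set_finite M.E).toFinset

/-- The dependent `p`-subsets `X ∋ e` of `E` whose `e`-free part `X.erase e` is independent. -/
noncomputable def xSets_S (e : α) (p : ℕ) : Finset (Finset α) :=
  ((groundFinset_S M).powersetCard p).filter
    (fun X => e ∈ X ∧ M.Indep ((X.erase e : Finset α) : Set α) ∧ ¬ M.Indep (X : Set α))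

/-- Membership in `xSets_S`: a `p`-subset of `E` containing `e`, dependent, with `X.erase e` independent. -/
lemma mem_xSets_iff_S {e : α} {p : ℕ} {X : Finset α} :
    X ∈ xSets_S M e p ↔ X ⊆ groundFinset_S M ∧ X.card = p ∧ e ∈ X ∧
      M.Indep ((X.erase e : Finset α) : Set α) ∧ ¬ M.Indep (X : Set α) := by
  unfold xSets_S
  rw [Finset.mem_filter, Finset.mem_powersetCard]
  tauto

/-- The `u`-subsets of `X.erase e` for `X ∈ xSets_S` are independent `u`-sets avoiding `e`. -/
lemma powersetCard_erase_subset_indepSets_S {e : α} {p : ℕ} {X : Finset α} (hX : X ∈ xSets_S M e p)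
    (u : ℕ) : (X.erase e).powersetCard u ⊆ (indepSets M u).filter (fun Z => e ∉ Z) := by
  rw [mem_xSets_iff_S] at hX
  obtain ⟨hXE, -, -, hind, -⟩ := hX
  intro Z hZ
  rw [Finset.mem_powersetCard] at hZ
  rw [Finset.mem_filter, mem_indepSets M]
  refine ⟨⟨hZ.1.trans ((Finset.erase_subset e X).trans hXE), hZ.2, ?_⟩, ?_⟩
  · exact hind.subset (by exact_mod_cast hZ.1)
  · intro heZ
    exact (Finset.notMem_erase e X) (hZ.1 heZ)

/-- Every `X ∈ xSets_S` is a dependent `p`-superset of each of its subsets. -/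
lemma xSets_subset_depFilter_S {e : α} {p : ℕ} {Z : Finset α} :
    (xSets_S M e p).filter (fun X => Z ⊆ X) ⊆
      ((groundFinset_S M).powersetCard p).filter (fun X => Z ⊆ X ∧ ¬ M.Indep (X : Set α)) := by
  intro X hX
  rw [Finset.mem_filter] at hX ⊢
  rw [mem_xSets_iff_S] at hX
  obtain ⟨⟨hXE, hXp, -, -, hdep⟩, hZX⟩ := hX
  rw [Finset.mem_powersetCard]
  exact ⟨⟨hXE, hXp⟩, hZX, hdep⟩

/-- `dep_p(Z) ≥ #{X ∈ xSets_S : Z ⊆ X}`. -/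
lemma card_xSets_filter_le_depCount_S {e : α} {p : ℕ} (Z : Finset α) :
    ((xSets_S M e p).filter (fun X => Z ⊆ X)).card ≤ depCount M p Z := by
  unfold depCount
  exact Finset.card_le_card (xSets_subset_depFilter_S M)

/-- **CLAIM A**: `#xSets_S · C(p−1, u) ≤ Σ_{Z ∈ I_u(M), e ∉ Z} dep_p(Z)` (for `u ≤ p − 1`): double count of the
pairs `Z ⊆ X` with `X ∈ xSets_S`, `Z ⊆ X.erase e`, `|Z| = u`. -/
theorem xSets_mul_choose_le_depSumAvoid_S (e : α) (u p : ℕ) :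
    (xSets_S M e p).card * (p - 1).choose u ≤ depSumAvoid M e u p := by
  unfold depSumAvoid
  -- Σ_{Z ∈ F} dep_p(Z) ≥ Σ_{Z ∈ F} #{X ∈ xSets_S : Z ⊆ X} = Σ_{X ∈ xSets_S} #{Z ∈ F : Z ⊆ X}
  --   ≥ Σ_{X ∈ xSets_S} #(X.erase e).powersetCard u = #xSets_S · C(p−1,u)
  set F := (indepSets M u).filter (fun Z => e ∉ Z) with hF
  calc (xSets_S M e p).card * (p - 1).choose u
      = ∑ X ∈ xSets_S M e p, (p - 1).choose u := by
        rw [Finset.sum_const, smul_eq_mul]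
    _ = ∑ X ∈ xSets_S M e p, ((X.erase e).powersetCard u).card := by
        refine Finset.sum_congr rfl (fun X hX => ?_)
        rw [Finset.card_powersetCard]
        rw [mem_xSets_iff_S] at hX
        obtain ⟨-, hXp, heX, -, -⟩ := hX
        rw [Finset.card_erase_of_mem heX, hXp]
    _ ≤ ∑ X ∈ xSets_S M e p, (F.filter (fun Z => Z ⊆ X)).card := by
        refine Finset.sum_le_sum (fun X hX => ?_)
        refine Finset.card_le_card ?_
        intro Z hZ
        rw [Finset.mem_filter]
        refine ⟨powersetCard_erase_subset_indepSets_S M hX u hZ, ?_⟩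
        rw [Finset.mem_powersetCard] at hZ
        exact hZ.1.trans (Finset.erase_subset e X)
    _ = ∑ Z ∈ F, ((xSets_S M e p).filter (fun X => Z ⊆ X)).card := by
        simp only [Finset.card_filter]
        rw [Finset.sum_comm]
    _ ≤ ∑ Z ∈ F, depCount M p Z := by
        refine Finset.sum_le_sum (fun Z _ => ?_)
        exact card_xSets_filter_le_depCount_S M Z

/-- For `X ∈ xSets_S`, `X.erase e` is a `(p−1)`-subset of `E ∖ e` that is dependent in `M ／ {e}`. -/
lemma erase_mem_depFilter_contract_S {e : α} (he : M.IsNonloop e) {p : ℕ} {X : Finset α}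
    (hX : X ∈ xSets_S M e p) (Z' : Finset α) (hZ' : Z' ⊆ X.erase e) :
    X.erase e ∈ ((groundFinset_S (M ／ {e})).powersetCard (p - 1)).filter
      (fun X' => Z' ⊆ X' ∧ ¬ (M ／ {e}).Indep (X' : Set α)) := by
  rw [mem_xSets_iff_S] at hX
  obtain ⟨hXE, hXp, heX, -, hdep⟩ := hX
  rw [Finset.mem_filter, Finset.mem_powersetCard]
  refine ⟨⟨?_, ?_⟩, hZ', ?_⟩
  · intro x hx
    rw [Finset.mem_erase] at hx
    show x ∈ ((M ／ {e}).set_finite (M ／ {e}).E).toFinset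
    rw [toFinset_contract_ground, Finset.mem_erase]
    exact ⟨hx.1, hXE hx.2⟩
  · rw [Finset.card_erase_of_mem heX, hXp]
  · intro hind
    rw [he.contractElem_indep_iff] at hind
    apply hdep
    have h2 := hind.2
    rw [← Finset.coe_insert, Finset.insert_erase heX] at h2
    exact h2

/-- The number of bad `q`-subsets `Z′` of `X.erase e` (those with `insert e Z′` dependent) is at most one
when every circuit through `e` has at least `q + 1` elements. -/
lemma card_bad_subsets_le_one_S {e : α} (he : M.IsNonloop e) {p q : ℕ} {X : Finset α}
    (hX : X ∈ xSets_S M e p)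
    (hc : ∀ C : Set α, M.IsCircuit C → e ∈ C → ((q + 1 : ℕ) : ℕ∞) ≤ C.encard) :
    (((X.erase e).powersetCard q).filter
      (fun Z' : Finset α => ¬ M.Indep (insert e (Z' : Set α)))).card ≤ 1 := by
  rw [mem_xSets_iff_S] at hX
  obtain ⟨-, -, -, hind, -⟩ := hX
  rw [Finset.card_le_one]
  intro Z₁ hZ₁ Z₂ hZ₂
  rw [Finset.mem_filter, Finset.mem_powersetCard] at hZ₁ hZ₂
  obtain ⟨⟨hZ₁X, hZ₁q⟩, hbad₁⟩ := hZ₁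
  obtain ⟨⟨hZ₂X, hZ₂q⟩, hbad₂⟩ := hZ₂
  -- each bad `Z'` gives the circuit `insert e Z'`
  have key : ∀ Z : Finset α, Z ⊆ X.erase e → Z.card = q → ¬ M.Indep (insert e (Z : Set α)) →
      M.IsCircuit (insert e (Z : Set α)) := by
    intro Z hZX hZq hbad
    have hZind : M.Indep (Z : Set α) := hind.subset (by exact_mod_cast hZX)
    have heZ : e ∉ (Z : Set α) := by
      intro h
      exact Finset.notMem_erase e X (hZX (by exact_mod_cast h))
    have hecl : e ∈ M.closure (Z : Set α) := by
      by_contra hcl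
      apply hbad
      rw [hZind.insert_indep_iff_of_notMem heZ]
      exact ⟨he.mem_ground, hcl⟩
    have hC := hZind.fundCircuit_isCircuit hecl heZ
    have hsub := M.fundCircuit_subset_insert e (Z : Set α)
    have hle := hc _ hC (M.mem_fundCircuit e (Z : Set α))
    have hcard : (insert e (Z : Set α)).encard = ((q + 1 : ℕ) : ℕ∞) := by
      rw [encard_insert_of_notMem heZ, encard_coe_eq_coe_finsetCard, hZq]
      push_cast
      rfl
    have heq : M.fundCircuit e (Z : Set α) = insert e (Z : Set α) :=
      (hC.finite).eq_of_subset_of_encard_le hsub (by rw [hcard]; exact hle)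
    rw [← heq]
    exact hC
  have hC₁ := key Z₁ hZ₁X hZ₁q hbad₁
  have hC₂ := key Z₂ hZ₂X hZ₂q hbad₂
  by_contra hne
  have he₁ : e ∉ (Z₁ : Set α) := fun h' => Finset.notMem_erase e X (hZ₁X (by exact_mod_cast h'))
  have he₂ : e ∉ (Z₂ : Set α) := fun h' => Finset.notMem_erase e X (hZ₂X (by exact_mod_cast h'))
  have hne' : insert e (Z₁ : Set α) ≠ insert e (Z₂ : Set α) := by
    intro h
    apply hne
    have h1 : insert e (Z₁ : Set α) \ {e} = insert e (Z₂ : Set α) \ {e} := by rw [h]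
    rw [insert_sdiff_self_of_notMem he₁, insert_sdiff_self_of_notMem he₂] at h1
    exact_mod_cast h1
  obtain ⟨C, hCsub, hC⟩ := hC₁.elimination hC₂ hne' e
  have hsub' : ((insert e (Z₁ : Set α)) ∪ insert e (Z₂ : Set α)) \ {e} ⊆
      ((X.erase e : Finset α) : Set α) := by
    intro x hx
    obtain ⟨hx1, hx2⟩ := hx
    rw [Set.mem_singleton_iff] at hx2
    rcases hx1 with h | h <;> rcases h with rfl | h
    · exact absurd rfl hx2
    · exact Finset.mem_coe.2 (hZ₁X (Finset.mem_coe.1 h))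
    · exact absurd rfl hx2
    · exact Finset.mem_coe.2 (hZ₂X (Finset.mem_coe.1 h))
  exact hC.not_indep (hind.subset (hCsub.trans hsub'))

/-- The good `q`-subsets of `X.erase e` (those with `insert e Z′` independent, i.e. `Z′ ∈ I_q(M／e)`) number at
least `C(p−1, q) − 1`. -/
lemma choose_pred_sub_one_le_card_good_S {e : α} (he : M.IsNonloop e) {p q : ℕ} {X : Finset α}
    (hX : X ∈ xSets_S M e p)
    (hc : ∀ C : Set α, M.IsCircuit C → e ∈ C → ((q + 1 : ℕ) : ℕ∞) ≤ C.encard) :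
    (p - 1).choose q - 1 ≤ (((X.erase e).powersetCard q).filter
      (fun Z' : Finset α => M.Indep (insert e (Z' : Set α)))).card := by
  have hsplit := Finset.card_filter_add_card_filter_not
    (s := (X.erase e).powersetCard q) (fun Z' : Finset α => M.Indep (insert e (Z' : Set α)))
  have hbad := card_bad_subsets_le_one_S M he hX hc
  have hall : ((X.erase e).powersetCard q).card = (p - 1).choose q := by
    rw [Finset.card_powersetCard]
    rw [mem_xSets_iff_S] at hX
    obtain ⟨-, hXp, heX, -, -⟩ := hX
    rw [Finset.card_erase_of_mem heX, hXp]
  omega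

/-- Good `q`-subsets of `X.erase e` are independent `q`-sets of `M ／ {e}`. -/
lemma good_subset_indepSets_contract_S {e : α} (he : M.IsNonloop e) {p q : ℕ} {X : Finset α}
    (hX : X ∈ xSets_S M e p) :
    ((X.erase e).powersetCard q).filter (fun Z' : Finset α => M.Indep (insert e (Z' : Set α))) ⊆
      (indepSets (M ／ {e}) q).filter (fun Z' => Z' ⊆ X.erase e) := by
  rw [mem_xSets_iff_S] at hX
  obtain ⟨hXE, -, -, -, -⟩ := hX
  intro Z' hZ'
  rw [Finset.mem_filter, Finset.mem_powersetCard] at hZ'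
  obtain ⟨⟨hZ'X, hZ'q⟩, hgood⟩ := hZ'
  rw [Finset.mem_filter, mem_indepSets (M ／ {e})]
  refine ⟨⟨?_, hZ'q, ?_⟩, hZ'X⟩
  · intro x hx
    show x ∈ ((M ／ {e}).set_finite (M ／ {e}).E).toFinset
    rw [toFinset_contract_ground, Finset.mem_erase]
    have := hZ'X hx
    rw [Finset.mem_erase] at this
    exact ⟨this.1, hXE this.2⟩
  · rw [he.contractElem_indep_iff]
    refine ⟨fun h => Finset.notMem_erase e X (hZ'X h), hgood⟩

/-- **CLAIM B**: if every circuit through `e` has size `≥ q + 1`, then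
`#xSets_S · (C(p−1, q) − 1) ≤ Σ_{Z′ ∈ I_q(M／e)} dep^{M／e}_{p−1}(Z′)`. -/
theorem xSets_mul_choose_pred_le_sum_depCount_contract_S {e : α} (he : M.IsNonloop e) (p q : ℕ)
    (hc : ∀ C : Set α, M.IsCircuit C → e ∈ C → ((q + 1 : ℕ) : ℕ∞) ≤ C.encard) :
    (xSets_S M e p).card * ((p - 1).choose q - 1) ≤
      ∑ Z' ∈ indepSets (M ／ {e}) q, depCount (M ／ {e}) (p - 1) Z' := by
  set G := indepSets (M ／ {e}) q with hG
  calc (xSets_S M e p).card * ((p - 1).choose q - 1)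
      = ∑ X ∈ xSets_S M e p, ((p - 1).choose q - 1) := by rw [Finset.sum_const, smul_eq_mul]
    _ ≤ ∑ X ∈ xSets_S M e p, (G.filter (fun Z' => Z' ⊆ X.erase e)).card := by
        refine Finset.sum_le_sum (fun X hX => ?_)
        exact le_trans (choose_pred_sub_one_le_card_good_S M he hX hc)
          (Finset.card_le_card (good_subset_indepSets_contract_S M he hX))
    _ = ∑ Z' ∈ G, ((xSets_S M e p).filter (fun X => Z' ⊆ X.erase e)).card := by
        simp only [Finset.card_filter]
        rw [Finset.sum_comm]
    _ ≤ ∑ Z' ∈ G, depCount (M ／ {e}) (p - 1) Z' := by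
        refine Finset.sum_le_sum (fun Z' _ => ?_)
        unfold depCount
        -- `X ↦ X.erase e` is injective on `xSets_S` (every member contains `e`)
        refine le_trans (Finset.card_le_card_of_injOn (fun X => X.erase e) ?_ ?_) le_rfl
        · intro X hX
          rw [Finset.mem_coe, Finset.mem_filter] at hX
          exact erase_mem_depFilter_contract_S M he hX.1 Z' hX.2
        · intro X hX X' hX' hEq
          rw [Finset.mem_coe, Finset.mem_filter, mem_xSets_iff_S] at hX hX'
          have h1 : insert e (X.erase e) = insert e (X'.erase e) := by
            show insert e ((fun X => X.erase e) X) = insert e ((fun X => X.erase e) X')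
            rw [hEq]
          rwa [Finset.insert_erase hX.1.2.2.1, Finset.insert_erase hX'.1.2.2.1] at h1

end PercRepro
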